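import Mathlib
import Literature.NumberTheory.Transcendental.KZLogCalculusProofs
import Literature.NumberTheory.Transcendental.KZRelationsLE
import Literature.NumberTheory.Transcendental.KZSemialgebraicComplex
import Literature.NumberTheory.Transcendental.SemialgebraicLineDeriv
import Literature.NumberTheory.Transcendental.KZIntervalPeriodProofs

/-!
# `TateFamilyKernelCurves` (stmt-KontsevichZagierPeriods-9132), line `Sketch` — stub `stub_anglePartToArcs`

ANGLE PART ↦ ARCS OF `du/(1+u²)`. The angle part of the real partial-fraction decomposition,
`r = [(0,1), Σⱼ βⱼ bⱼ/((t−aⱼ)²+bⱼ²)]` (`bⱼ > 0`, all constants real algebraic, and Baker's splitting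
`βⱼ = Σ_k c_k n_kj` with `c_k` real algebraic, `n_kj ∈ ℤ`), satisfies
`[r] − Σ_k scale(c_k) (Σⱼ n_kj • [arcⱼ]) ∈ relations`, where `arcⱼ = ρ j` is any representation
`[(−aⱼ/bⱼ, (1−aⱼ)/bⱼ), du/(1+u²)]`.

Proof.
* Kernel representations `T j = [(0,1), bⱼ/((t−aⱼ)²+bⱼ²)]` (`ap_exists_kernelRep`).
* ONE change of variables (rule 2) per `j`: the affine chart `u = (t − aⱼ)/bⱼ` of `ℝ¹`, derivative
  `(1/bⱼ) • id`, `|det| = 1/bⱼ`, image `(−aⱼ/bⱼ, (1−aⱼ)/bⱼ)`, pull-back identity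
  `1/(1+((t−a)/b)²) · (1/b) = b/((t−a)²+b²)`; hence `[T j] − [ρ j] ∈ relations` (`ap_affineMove`),
  and the same after scaling by `c_k` (`KZ.scale_mem_relations`).
* Iterated integrand additivity (rule 1b, `KZ.of_sub_of_sub_sum_mem_relations`) with integer
  weights (`ap_of_sub_sum_zsmul_mem`; an integer multiple `n • [σ, f]` is `[σ, n f]` modulo
  relations, `ap_of_constMul_sub_zsmul_mem`): `[r] ≡ Σⱼ [βⱼ T j]` and
  `[βⱼ T j] ≡ Σ_k n_kj • [c_k T j]` since `βⱼ f = Σ_k n_kj (c_k f)` pointwise.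
* Bookkeeping in the free abelian group (`KZ.scale` is additive,
  `scale a (of s) = of (s.constMul a)`).

Tree inputs: the KZ calculus API (`KZCalculus`, `KZLogCalculusProofs`, `KZRelationsLE`) and the
semialgebraic toolkit (`KZSemialgebraicComplex`, `SemialgebraicLineDeriv`,
`KZIntervalPeriodProofs`).
-/

noncomputable section

open MeasureTheory Set
open Literature.NumberTheory.Transcendental
open Literature.ModelTheory.ExponentialFields (IsSemialgebraic isSemialgebraic_univ)

namespace Summit.KontsevichZagierPeriods.InverseLandau

/-! ## Integer multiples and integer-weighted integrand additivity -/

/-- `[σ, a f] − n • [σ, f] ∈ relations` for `a = n ∈ ℕ`: iterated integrand additivity (rule 1b),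
the case `n = 0` being a representation with vanishing integrand.
[cite: KontsevichZagier2001, §1.2] -/
theorem ap_of_constMul_sub_nsmul_mem {N : ℕ} (s : KZ.IntegralRep N) :
    ∀ (n : ℕ) {a : ℝ} (ha : IsAlgebraic ℚ a), a = n →
      KZ.of (s.constMul a ha) - n • KZ.of s ∈ KZ.relations
  | 0, a, ha, han => by
    rw [zero_nsmul, sub_zero]
    refine KZ.of_mem_relations_of_eqOn_zero _ fun x _ => ?_
    simp [KZ.IntegralRep.integrand_constMul, han]
  | n + 1, a, ha, han => by
    have h1 : KZ.of (s.constMul a ha) - KZ.of (s.constMul (n : ℝ) (isAlgebraic_nat n)) - KZ.of s ∈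
        KZ.relations :=
      KZ.integrandAddRel_subset_relations
        ⟨N, s.constMul a ha, s.constMul (n : ℝ) (isAlgebraic_nat n), s, rfl, rfl, fun x _ => by
          simp only [KZ.IntegralRep.integrand_constMul, Pi.add_apply, han, Nat.cast_succ]
          ring, rfl⟩
    have h2 := ap_of_constMul_sub_nsmul_mem s n (isAlgebraic_nat n) rfl
    have e : KZ.of (s.constMul a ha) - (n + 1) • KZ.of s =
        (KZ.of (s.constMul a ha) - KZ.of (s.constMul (n : ℝ) (isAlgebraic_nat n)) - KZ.of s) +
          (KZ.of (s.constMul (n : ℝ) (isAlgebraic_nat n)) - n • KZ.of s) := by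
      rw [succ_nsmul]
      abel
    rw [e]
    exact KZ.relations.add_mem h1 h2

/-- `[σ, a f] − n • [σ, f] ∈ relations` for `a = n ∈ ℤ` (negative multiples: `[σ, −k f] + [σ, k f]`
is a relation). [cite: KontsevichZagier2001, §1.2] -/
theorem ap_of_constMul_sub_zsmul_mem {N : ℕ} (s : KZ.IntegralRep N) (n : ℤ) {a : ℝ}
    (ha : IsAlgebraic ℚ a) (han : a = n) :
    KZ.of (s.constMul a ha) - n • KZ.of s ∈ KZ.relations := by
  obtain ⟨k, rfl | rfl⟩ := Int.eq_nat_or_neg n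
  · rw [natCast_zsmul]
    exact ap_of_constMul_sub_nsmul_mem s k ha (by rw [han, Int.cast_natCast])
  · have h1 : KZ.of (s.constMul (k : ℝ) (isAlgebraic_nat k)) + KZ.of (s.constMul a ha) ∈
        KZ.relations :=
      KZ.of_add_of_mem_relations_of_eqOn_neg rfl fun x _ => by
        simp [KZ.IntegralRep.integrand_constMul, han]
    have h2 := ap_of_constMul_sub_nsmul_mem s k (isAlgebraic_nat k) rfl
    have e : KZ.of (s.constMul a ha) - (-(k : ℤ)) • KZ.of s =
        (KZ.of (s.constMul (k : ℝ) (isAlgebraic_nat k)) + KZ.of (s.constMul a ha)) -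
          (KZ.of (s.constMul (k : ℝ) (isAlgebraic_nat k)) - k • KZ.of s) := by
      rw [neg_zsmul, natCast_zsmul]
      abel
    rw [e]
    exact KZ.relations.sub_mem h1 h2

/-- **Integer-weighted integrand additivity.** If `R`, `Rs i` have a common domain on which
`R.integrand = Σᵢ nᵢ · (Rs i).integrand` with INTEGER weights `nᵢ`, then `[R] − Σᵢ nᵢ • [Rs i]` is a
relation: `KZ.of_sub_of_sub_sum_mem_relations` with the scaled representations `[σ, nᵢ fᵢ]` and a
zero representation, plus `ap_of_constMul_sub_zsmul_mem`. [cite: KontsevichZagier2001, §1.2] -/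
theorem ap_of_sub_sum_zsmul_mem {N K : ℕ} (R : KZ.IntegralRep N) (Rs : Fin K → KZ.IntegralRep N)
    (n : Fin K → ℤ) (hd : ∀ i, (Rs i).domain = R.domain)
    (h : Set.EqOn R.integrand (fun x => ∑ i, (n i : ℝ) * (Rs i).integrand x) R.domain) :
    KZ.of R - ∑ i, n i • KZ.of (Rs i) ∈ KZ.relations := by
  obtain ⟨Z, hZd, hZi⟩ := KZ.exists_zeroRep R.isSemialgebraic_domain
  have h1 := KZ.of_sub_of_sub_sum_mem_relations K R Z
    (fun i => (Rs i).constMul (n i : ℝ) (isAlgebraic_int (n i))) hZd (fun i => hd i)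
    (fun x hx => by
      simp only [hZi, Pi.zero_apply, zero_add, KZ.IntegralRep.integrand_constMul]
      exact h hx)
  have h2 : KZ.of Z ∈ KZ.relations :=
    KZ.of_mem_relations_of_eqOn_zero Z (by rw [hZi]; exact fun _ _ => rfl)
  have h3 : ∀ i, KZ.of ((Rs i).constMul (n i : ℝ) (isAlgebraic_int (n i))) - n i • KZ.of (Rs i) ∈
      KZ.relations := fun i => ap_of_constMul_sub_zsmul_mem (Rs i) (n i) _ rfl
  have e : KZ.of R - ∑ i, n i • KZ.of (Rs i) =
      (KZ.of R - KZ.of Z - ∑ i, KZ.of ((Rs i).constMul (n i : ℝ) (isAlgebraic_int (n i)))) +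
        KZ.of Z +
        ∑ i, (KZ.of ((Rs i).constMul (n i : ℝ) (isAlgebraic_int (n i))) - n i • KZ.of (Rs i)) := by
    rw [Finset.sum_sub_distrib]
    abel
  rw [e]
  exact KZ.relations.add_mem (KZ.relations.add_mem h1 h2) (sum_mem fun i _ => h3 i)

/-! ## One-dimensional representations -/

/-- Open intervals of `ℝ¹` with real-algebraic endpoints are `ℚ`-semialgebraic. [folklore] -/
theorem ap_isSemialgebraic_Ioo {α α' : ℝ} (hα : IsAlgebraic ℚ α) (hα' : IsAlgebraic ℚ α') :
    IsSemialgebraic ℚ {x : Fin 1 → ℝ | x 0 ∈ Set.Ioo α α'} := by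
  have hu : IsSemialgebraic ℚ (univ : Set (Fin 1 → ℝ)) := isSemialgebraic_univ
  have hx : IsSemialgebraicFunOn ℚ univ (fun x : Fin 1 → ℝ => x 0) :=
    isSemialgebraicFunOn_apply hu 0
  have h1 := ((isSemialgebraicFunOn_const_of_isAlgebraic hu hα).fun_sub hx).isSemialgebraic_sep_neg
  have h2 := (hx.fun_sub (isSemialgebraicFunOn_const_of_isAlgebraic hu hα')).isSemialgebraic_sep_neg
  convert h1.inter h2 using 1
  ext x
  simp only [mem_setOf_eq, mem_Ioo, mem_inter_iff, mem_univ, true_and, sub_neg]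

/-- A function continuous on `[α, α′]` is integrable, as a function of `x 0`, on the open interval
of `ℝ¹` (transport along `MeasurableEquiv.funUnique`). [folklore] -/
theorem ap_integrableOn_fin_one {f : ℝ → ℝ} {α α' : ℝ} (hf : ContinuousOn f (Set.Icc α α')) :
    IntegrableOn (fun x : Fin 1 → ℝ => f (x 0)) {x : Fin 1 → ℝ | x 0 ∈ Set.Ioo α α'} := by
  have hmp := MeasureTheory.volume_preserving_funUnique (Fin 1) ℝ
  have hpre : {x : Fin 1 → ℝ | x 0 ∈ Set.Ioo α α'} =
      MeasurableEquiv.funUnique (Fin 1) ℝ ⁻¹' Ioo α α' := by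
    ext x
    simp [MeasurableEquiv.funUnique, Fin.default_eq_zero]
  rw [hpre]
  exact (hmp.integrableOn_comp_preimage (MeasurableEquiv.measurableEmbedding _)).mpr
    ((hf.integrableOn_Icc).mono_set Ioo_subset_Icc_self)

/-- The kernel representation `[(0,1), b/((t−a)²+b²)]` exists for real algebraic `a`, `b > 0`.
[folklore] -/
theorem ap_exists_kernelRep {a b : ℝ} (ha : IsAlgebraic ℚ a) (hb : IsAlgebraic ℚ b) (hb0 : 0 < b) :
    ∃ T : KZ.IntegralRep 1, T.domain = {x : Fin 1 → ℝ | x 0 ∈ Set.Ioo (0 : ℝ) 1} ∧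
      T.integrand = fun x => b / ((x 0 - a) ^ 2 + b ^ 2) := by
  have hW : IsSemialgebraic ℚ {x : Fin 1 → ℝ | x 0 ∈ Set.Ioo (0 : ℝ) 1} :=
    ap_isSemialgebraic_Ioo isAlgebraic_zero isAlgebraic_one
  have hV : ∀ t : ℝ, 0 < (t - a) ^ 2 + b ^ 2 := fun t => by positivity
  have hsa : IsSemialgebraicFunOn ℚ {x : Fin 1 → ℝ | x 0 ∈ Set.Ioo (0 : ℝ) 1}
      (fun x => b / ((x 0 - a) ^ 2 + b ^ 2)) :=
    (isSemialgebraicFunOn_const_of_isAlgebraic hW hb).div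
      ((((isSemialgebraicFunOn_apply hW 0).fun_sub
        (isSemialgebraicFunOn_const_of_isAlgebraic hW ha)).fun_pow 2).fun_add
        ((isSemialgebraicFunOn_const_of_isAlgebraic hW hb).fun_pow 2))
      fun x _ => (hV (x 0)).ne'
  have hc : ContinuousOn (fun t : ℝ => b / ((t - a) ^ 2 + b ^ 2)) (Set.Icc 0 1) :=
    continuousOn_const.div (by fun_prop) fun t _ => (hV t).ne'
  exact ⟨⟨{x : Fin 1 → ℝ | x 0 ∈ Set.Ioo (0 : ℝ) 1}, fun x => b / ((x 0 - a) ^ 2 + b ^ 2), hW, hsa,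
    ap_integrableOn_fin_one hc⟩, rfl, rfl⟩

/-! ## The affine chart `u = (t − a)/b` as ONE change-of-variables move -/

/-- The chart `Φ(x) = ((x₀ − a)/b)` of `ℝ¹` has derivative `(1/b) • id`. [folklore] -/
theorem ap_hasFDerivAt (a b : ℝ) (x : Fin 1 → ℝ) :
    HasFDerivAt (fun y : Fin 1 → ℝ => fun _ : Fin 1 => (y 0 - a) / b)
      ((1 / b) • ContinuousLinearMap.id ℝ (Fin 1 → ℝ)) x := by
  rw [hasFDerivAt_pi']
  intro i
  obtain rfl : i = 0 := Fin.fin_one_eq_zero i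
  have h0 : HasFDerivAt (fun f : Fin 1 → ℝ => f 0)
      (ContinuousLinearMap.proj (R := ℝ) (φ := fun _ : Fin 1 => ℝ) 0) x :=
    hasFDerivAt_apply 0 x
  have h1 : HasDerivAt (fun t : ℝ => (t - a) / b) (1 / b) (x 0) :=
    ((hasDerivAt_id (x 0)).sub_const a).div_const b
  refine (h1.comp_hasFDerivAt x h0).congr_fderiv (ContinuousLinearMap.ext fun v => ?_)
  simp

/-- `|det (c • id_{ℝ¹})| = c` for `0 < c`. [folklore] -/
theorem ap_abs_det {c : ℝ} (hc : 0 < c) :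
    |(c • ContinuousLinearMap.id ℝ (Fin 1 → ℝ)).det| = c := by
  have : (c • ContinuousLinearMap.id ℝ (Fin 1 → ℝ)).det = c := by
    change LinearMap.det (((c • ContinuousLinearMap.id ℝ (Fin 1 → ℝ) :
      (Fin 1 → ℝ) →L[ℝ] (Fin 1 → ℝ))) : (Fin 1 → ℝ) →ₗ[ℝ] (Fin 1 → ℝ)) = c
    rw [ContinuousLinearMap.toLinearMap_smul, ContinuousLinearMap.coe_id, LinearMap.det_smul,
      LinearMap.det_id, Module.finrank_fin_fun]
    simp
  rw [this, abs_of_pos hc]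

/-- The chart is injective (`b ≠ 0`). [folklore] -/
theorem ap_injOn (a : ℝ) {b : ℝ} (hb : b ≠ 0) (σ : Set (Fin 1 → ℝ)) :
    InjOn (fun y : Fin 1 → ℝ => fun _ : Fin 1 => (y 0 - a) / b) σ := by
  intro x _ y _ hxy
  have h0 : (x 0 - a) / b = (y 0 - a) / b := congrFun hxy 0
  rw [div_left_inj' hb, sub_left_inj] at h0
  funext i
  obtain rfl : i = 0 := Fin.fin_one_eq_zero i
  exact h0

/-- The chart maps `(u, v)` ONTO `((u−a)/b, (v−a)/b)` (`b > 0`; inverse `t = b u + a`).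
[folklore] -/
theorem ap_image {a b u v : ℝ} (hb : 0 < b) :
    (fun y : Fin 1 → ℝ => fun _ : Fin 1 => (y 0 - a) / b) '' {x | x 0 ∈ Ioo u v} =
      {x | x 0 ∈ Ioo ((u - a) / b) ((v - a) / b)} := by
  ext y
  constructor
  · rintro ⟨x, hx, rfl⟩
    have hx' : x 0 ∈ Ioo u v := hx
    show (x 0 - a) / b ∈ Ioo ((u - a) / b) ((v - a) / b)
    exact ⟨div_lt_div_of_pos_right (by linarith [hx'.1]) hb,
      div_lt_div_of_pos_right (by linarith [hx'.2]) hb⟩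
  · intro hy
    have hy' : y 0 ∈ Ioo ((u - a) / b) ((v - a) / b) := hy
    rw [mem_Ioo, div_lt_iff₀ hb, lt_div_iff₀ hb] at hy'
    refine ⟨fun _ => b * y 0 + a, ?_, ?_⟩
    · show b * y 0 + a ∈ Ioo u v
      constructor <;> nlinarith [hy'.1, hy'.2]
    · funext i
      show (b * y 0 + a - a) / b = y i
      obtain rfl : i = 0 := Fin.fin_one_eq_zero i
      field_simp
      ring

/-- **The pull-back identity** `1/(1 + ((t−a)/b)²) · (1/b) = b/((t−a)²+b²)` (`b > 0`). [folklore] -/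
theorem ap_pullback {a b : ℝ} (hb : 0 < b) (t : ℝ) :
    1 / (1 + ((t - a) / b) ^ 2) * (1 / b) = b / ((t - a) ^ 2 + b ^ 2) := by
  have hb' : b ≠ 0 := hb.ne'
  have hV : (t - a) ^ 2 + b ^ 2 ≠ 0 := by positivity
  rw [div_pow, one_add_div (pow_ne_zero 2 hb'), one_div_div, div_mul_div_comm, mul_one,
    div_eq_div_iff (mul_ne_zero (by positivity) hb') hV]
  ring

/-- The chart is a `ℚ`-semialgebraic map on every `ℚ`-semialgebraic set (`a`, `b ≠ 0` real
algebraic: constants with real-algebraic values are `ℚ`-semialgebraic functions). [folklore] -/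
theorem ap_isSemialgebraicMapOn {a b : ℝ} (ha : IsAlgebraic ℚ a) (hb : IsAlgebraic ℚ b)
    (hb0 : b ≠ 0) {σ : Set (Fin 1 → ℝ)} (hσ : IsSemialgebraic ℚ σ) :
    IsSemialgebraicMapOn ℚ σ (fun y : Fin 1 → ℝ => fun _ : Fin 1 => (y 0 - a) / b) :=
  IsSemialgebraicMapOn.of_forall hσ fun _ =>
    ((isSemialgebraicFunOn_apply hσ 0).fun_sub
      (isSemialgebraicFunOn_const_of_isAlgebraic hσ ha)).div
        (isSemialgebraicFunOn_const_of_isAlgebraic hσ hb) fun _ _ => hb0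

/-- **The affine move.** For real algebraic `a`, `b > 0` and representations
`T = [(u,v), b/((t−a)²+b²)]`, `T' = [((u−a)/b, (v−a)/b), 1/(1+u²)]` (given by their domains and
their integrands ON the domains): `[T] − [T'] ∈ changeOfVariablesRel ⊆ relations`, by the chart
`u = (t − a)/b` (rule 2, Jacobian `1/b`). [cite: KontsevichZagier2001, §1.2] -/
theorem ap_affineMove {a b : ℝ} (ha : IsAlgebraic ℚ a) (hb : IsAlgebraic ℚ b) (hb0 : 0 < b)
    {u v : ℝ} (T T' : KZ.IntegralRep 1) (hTd : T.domain = {x | x 0 ∈ Set.Ioo u v})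
    (hTi : Set.EqOn T.integrand (fun x => b / ((x 0 - a) ^ 2 + b ^ 2)) T.domain)
    (hT'd : T'.domain = {x | x 0 ∈ Set.Ioo ((u - a) / b) ((v - a) / b)})
    (hT'i : Set.EqOn T'.integrand (fun x => 1 / (1 + (x 0) ^ 2)) T'.domain) :
    KZ.of T - KZ.of T' ∈ KZ.relations := by
  have himage : T'.domain =
      (fun y : Fin 1 → ℝ => fun _ : Fin 1 => (y 0 - a) / b) '' T.domain := by
    rw [hTd, ap_image hb0, hT'd]
  refine KZ.changeOfVariablesRel_subset_relations
    ⟨1, T, T', fun y : Fin 1 → ℝ => fun _ : Fin 1 => (y 0 - a) / b,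
      fun _ => (1 / b) • ContinuousLinearMap.id ℝ (Fin 1 → ℝ),
      ap_isSemialgebraicMapOn ha hb hb0.ne' T.isSemialgebraic_domain,
      fun x _ => (ap_hasFDerivAt a b x).hasFDerivWithinAt,
      ap_injOn a hb0.ne' T.domain, himage, fun x hx => ?_, rfl⟩
  have hΦx : (fun y : Fin 1 → ℝ => fun _ : Fin 1 => (y 0 - a) / b) x ∈ T'.domain :=
    himage ▸ mem_image_of_mem _ hx
  have e1 : T.integrand x = b / ((x 0 - a) ^ 2 + b ^ 2) := hTi hx
  have e2 : T'.integrand (fun _ : Fin 1 => (x 0 - a) / b) = 1 / (1 + ((x 0 - a) / b) ^ 2) :=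
    hT'i hΦx
  show T.integrand x = T'.integrand (fun _ : Fin 1 => (x 0 - a) / b) *
    |((1 / b) • ContinuousLinearMap.id ℝ (Fin 1 → ℝ)).det|
  rw [e1, e2, ap_abs_det (one_div_pos.2 hb0)]
  exact (ap_pullback hb0 (x 0)).symm

/-! ## The stub -/

/-- **S5 (angle part ↦ arcs of `du/(1+u²)`).** With `βⱼ = Σ_k c_k n_kj` (`c_k` real algebraic,
`n_kj ∈ ℤ`) and `bⱼ > 0`:
`[(0,1), Σⱼ βⱼ bⱼ/((t−aⱼ)²+bⱼ²)] − Σ_k scale(c_k) (Σⱼ n_kj • [arcⱼ]) ∈ relations`,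
where `arcⱼ = [(−aⱼ/bⱼ, (1−aⱼ)/bⱼ), 1/(1+u²)]` is the image of `(0,1)` under the affine chart
`u = (t − aⱼ)/bⱼ` (rule 2, Jacobian `1/bⱼ`), by integrand additivity (rule 1b) and `KZ.scale`.
[cite: KontsevichZagier2001, §1.2] -/
theorem stub_anglePartToArcs : ∀ (m R : ℕ) (a b β : Fin m → ℝ) (n : Fin R → Fin m → ℤ)
    (c : Fin R → ℝ) (hc : ∀ k, IsAlgebraic ℚ (c k)) (r : KZ.IntegralRep 1)
    (ρ : Fin m → KZ.IntegralRep 1),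
    (∀ j, IsAlgebraic ℚ (a j) ∧ IsAlgebraic ℚ (b j) ∧ IsAlgebraic ℚ (β j) ∧ 0 < b j) →
    (∀ j, β j = ∑ k, c k * n k j) →
    r.domain = {x | x 0 ∈ Set.Ioo (0 : ℝ) 1} →
    Set.EqOn r.integrand (fun x => ∑ j, β j * b j / ((x 0 - a j) ^ 2 + (b j) ^ 2)) r.domain →
    (∀ j, (ρ j).domain = {x | x 0 ∈ Set.Ioo (-a j / b j) ((1 - a j) / b j)} ∧
      Set.EqOn (ρ j).integrand (fun x => 1 / (1 + (x 0) ^ 2)) (ρ j).domain) →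
    KZ.of r - ∑ k, KZ.scale (c k) (hc k) (∑ j, n k j • KZ.of (ρ j)) ∈ KZ.relations := by
  intro m R a b β n c hc r ρ halg hβ hdom hr hρ
  -- the kernel representations `T j = [(0,1), bⱼ/((t−aⱼ)²+bⱼ²)]`
  choose T hTd hTi using fun j => ap_exists_kernelRep (halg j).1 (halg j).2.1 (halg j).2.2.2
  -- (i) one affine change of variables per `j`, then scaled by `c k`
  have hTρ : ∀ j, KZ.of (T j) - KZ.of (ρ j) ∈ KZ.relations := fun j =>
    ap_affineMove (halg j).1 (halg j).2.1 (halg j).2.2.2 (T j) (ρ j) (hTd j)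
      (by rw [hTi j]; exact fun x _ => rfl) (by rw [zero_sub]; exact (hρ j).1) (hρ j).2
  have hTρ' : ∀ k j, KZ.of ((T j).constMul (c k) (hc k)) - KZ.of ((ρ j).constMul (c k) (hc k)) ∈
      KZ.relations := fun k j => by
    simpa only [map_sub, KZ.scale_of] using KZ.scale_mem_relations (c k) (hc k) (hTρ j)
  -- (ii) `[r] ≡ Σⱼ [βⱼ T j]` (integrand additivity)
  have hβa : ∀ j, IsAlgebraic ℚ (β j) := fun j => (halg j).2.2.1
  have hrS : KZ.of r - ∑ j, (1 : ℤ) • KZ.of ((T j).constMul (β j) (hβa j)) ∈ KZ.relations :=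
    ap_of_sub_sum_zsmul_mem r (fun j => (T j).constMul (β j) (hβa j)) (fun _ => 1)
      (fun j => (hTd j).trans hdom.symm)
      (fun x hx => by
        rw [hr hx]
        simp only [Int.cast_one, one_mul, KZ.IntegralRep.integrand_constMul, hTi]
        exact Finset.sum_congr rfl fun j _ => mul_div_assoc _ _ _)
  -- (iii) `[βⱼ T j] ≡ Σ_k n_kj • [c_k T j]` (integrand additivity, `βⱼ = Σ_k c_k n_kj`)
  have hSU : ∀ j, KZ.of ((T j).constMul (β j) (hβa j)) -
      ∑ k, n k j • KZ.of ((T j).constMul (c k) (hc k)) ∈ KZ.relations := fun j =>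
    ap_of_sub_sum_zsmul_mem _ (fun k => (T j).constMul (c k) (hc k)) (fun k => n k j)
      (fun _ => rfl)
      (fun x _ => by
        simp only [KZ.IntegralRep.integrand_constMul, hβ j, Finset.sum_mul]
        exact Finset.sum_congr rfl fun k _ => by ring)
  -- (iv) bookkeeping in the free abelian group
  have eL : ∑ k, KZ.scale (c k) (hc k) (∑ j, n k j • KZ.of (ρ j)) =
      ∑ j, ∑ k, n k j • KZ.of ((ρ j).constMul (c k) (hc k)) := by
    simp only [map_sum, map_zsmul, KZ.scale_of]
    exact Finset.sum_comm
  have e : KZ.of r - ∑ j, ∑ k, n k j • KZ.of ((ρ j).constMul (c k) (hc k)) =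
      (KZ.of r - ∑ j, (1 : ℤ) • KZ.of ((T j).constMul (β j) (hβa j))) +
        ∑ j, (KZ.of ((T j).constMul (β j) (hβa j)) -
          ∑ k, n k j • KZ.of ((T j).constMul (c k) (hc k))) +
        ∑ j, ∑ k, n k j • (KZ.of ((T j).constMul (c k) (hc k)) -
          KZ.of ((ρ j).constMul (c k) (hc k))) := by
    simp only [one_zsmul, smul_sub, Finset.sum_sub_distrib]
    abel
  rw [eL, e]
  exact KZ.relations.add_mem (KZ.relations.add_mem hrS (sum_mem fun j _ => hSU j))
    (sum_mem fun j _ => sum_mem fun k _ => KZ.relations.zsmul_mem (hTρ' k j) _)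

end Summit.KontsevichZagierPeriods.InverseLandau

end
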